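import Mathlib
import HarnessLib
import Summits.NavierStokesRegularity.NavierStokesRegularity.Theorems.PoloidalWindowDoorLrcModEntireShearedCoordinates
import Summits.NavierStokesRegularity.NavierStokesRegularity.Theorems.PoloidalWindowDoorPoloidalWindowRigidityAxisymmetric
import Summits.NavierStokesRegularity.NavierStokesRegularity.Theorems.PoloidalWindowDoorPoloidalWindowRigidityConstantShearSlice

/-!
# Route `PoloidalWindowDoor`, item `LrcModEntire` (stmt-NavierStokesRegularity-20428), cell (Q4-sonic), slot `stub_Q4sonicLineNeg`, case I —
# S4b OF THE ASSEMBLY A-I: THE KINEMATIC HALF OF THE MIXED SYSTEM IN SHEARED COORDINATES (`∂_mP = ∂_sQ`, `∂_mQ = −∂_sP − (∂_z′ − d_z∂_m)g`)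

Cell ns-regularity-ideate, helper seat ns-k2-port-2 g8 under the LEAD of item 20428 (ns-poloidal-K2-p3 g17, memo `T2B-g17.md` v4 §7 S4 simplified 19:33Z: unknowns
`g = ∂_eU₂`, `P = ⟪∂_eU_h, e⟫`, `Q = ⟪∂_eU_h, Je⟫`, no potential; B-CK2 appendix `vanishesToOrder_all_of_mixedSystem`); `--supports stmt-NavierStokesRegularity-20428
--as helper`.  Class-free.

For a space–time field `W : ℝ × ℝ³ → ℝ³` (in the application `W(t,x) = U(t,x)` or its time shift) and a horizontal unit vector `e` put
`gST W e (q) := DW(q)[(0,e)]₂`, `PST W e (q) := ⟪e, DW(q)[(0,e)]⟫`, `QST W e (q) := ⟪Je, DW(q)[(0,e)]⟫` (the `e`-derivatives of `U₂`, `U·e`, `U·Je`), and pull them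
back by the moving shear `Φ` of `…ShearedCoordinates` (`G ∘ Φ`, tube `O × ℝ`, `pd`/`dN`/`tg` of B-CK2).  With `W ∈ C^∞(T × ℝ³)` (`T` open), `d ∈ C^∞(D)`:
* `pd_dN_PST_eq` — slices POLOIDAL (`(curl W(t,·))₂ = 0`) ⇒ **`∂_m(P∘Φ) = ∂_s(Q∘Φ)`** on the tube (symmetry of the horizontal block of `DU`, differentiated along `e`);
* `pd_dN_QST_eq` — slices DIVERGENCE-FREE ⇒ **`∂_m(Q∘Φ) = −∂_s(P∘Φ) − (∂_z′ − d_z∂_m)(g∘Φ)`** on the tube (the trace `⟪DU e,e⟫ + ⟪DU Je,Je⟫ + ∂₂U₂ = 0`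
  differentiated along `e`, with `(∂_z′ − d_z∂_m)(g∘Φ) = (∂_{e₂}g)∘Φ` from `…ShearedCoordinates.pd_tgZ_sub_comp_shearMap`);
* `contDiffOn_gST/PST/QST` (smooth on `T × ℝ³`, so `…contDiffOn_comp_shearMap` applies) and `analyticOnNhd_gST_slice` (analytic slices ⇒ analytic slices, the
  input of `…analyticOnNhd_normalLine_comp_shearMap`).
These are the two first-order rows of the LEAD's mixed system; the second-order row ((E3) for `g`) is S4c.
WHAT THIS IS NOT: not a claim about Navier–Stokes regularity — kinematic identities for the research slot `stub_Q4sonicLineNeg` (registry twist_split v13); no stub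
is closed here; items 20428 / 19708 / 27893 OPEN.
-/

noncomputable section

set_option linter.dupNamespace false
set_option linter.style.longLine false

namespace Summit.NavierStokesRegularity.NavierStokesRegularity.Theorems.PoloidalWindowDoorLrcModEntireShearedKinematics

open Set Function Filter Topology
open scoped RealInnerProductSpace InnerProductSpace ContDiff
open Literature.Analysis
open Summit.NavierStokesRegularity.NavierStokesRegularity.Theorems.PoloidalWindowDoorLrcModEntireSheetSystemUniqueness
open Summit.NavierStokesRegularity.NavierStokesRegularity.Theorems.PoloidalWindowDoorLrcModEntireSheetFlattenTools
open Summit.NavierStokesRegularity.NavierStokesRegularity.Theorems.PoloidalWindowDoorLrcModEntireShearedCoordinates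
open Summit.NavierStokesRegularity.NavierStokesRegularity.Theorems.PoloidalWindowDoorPoloidalWindowRigidityAxisymmetric
open Summit.NavierStokesRegularity.NavierStokesRegularity.Theorems.PoloidalWindowDoorPoloidalWindowRigidityConstantShearSlice

/-- Shorthand for `ℝ³`. -/
abbrev E3 : Type := EuclideanSpace ℝ (Fin 3)

variable (W : ℝ × E3 → E3) (e : E3)

/-- `g = ∂_eU₂` as a space–time function: `DW(q)[(0,e)]₂`. -/
def gST (q : ℝ × E3) : ℝ := fderiv ℝ W q ((0 : ℝ), e) 2
/-- `P = ⟪∂_eU_h, e⟫` as a space–time function: `⟪e, DW(q)[(0,e)]⟫` (`e` horizontal). -/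
def PST (q : ℝ × E3) : ℝ := ⟪e, fderiv ℝ W q ((0 : ℝ), e)⟫_ℝ
/-- `Q = ⟪∂_eU_h, Je⟫` as a space–time function: `⟪Je, DW(q)[(0,e)]⟫`. -/
def QST (q : ℝ × E3) : ℝ := ⟪Jvec e, fderiv ℝ W q ((0 : ℝ), e)⟫_ℝ

/-- The linear functional `L ↦ ⟪c, L u⟫` on `ℝ × ℝ³ →L ℝ³`. -/
def evalInner (u : ℝ × E3) (c : E3) : (ℝ × E3 →L[ℝ] E3) →L[ℝ] ℝ := (innerSL ℝ c).comp (ContinuousLinearMap.apply ℝ E3 u)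
/-- The linear functional `L ↦ (L u)₂`. -/
def evalCoord (u : ℝ × E3) : (ℝ × E3 →L[ℝ] E3) →L[ℝ] ℝ := (EuclideanSpace.proj (𝕜 := ℝ) (2 : Fin 3)).comp (ContinuousLinearMap.apply ℝ E3 u)

/-- Evaluation of `evalInner`. -/
@[simp] theorem evalInner_apply (u : ℝ × E3) (c : E3) (L : ℝ × E3 →L[ℝ] E3) : evalInner u c L = ⟪c, L u⟫_ℝ := by
  simp [evalInner]
/-- Evaluation of `evalCoord`. -/
@[simp] theorem evalCoord_apply (u : ℝ × E3) (L : ℝ × E3 →L[ℝ] E3) : evalCoord u L = L u 2 := by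
  simp [evalCoord]

/-- `PST` as a linear functional of `DW`. -/
theorem PST_eq_comp : PST W e = evalInner ((0 : ℝ), e) e ∘ fderiv ℝ W := by funext q; simp [PST]
/-- `QST` as a linear functional of `DW`. -/
theorem QST_eq_comp : QST W e = evalInner ((0 : ℝ), e) (Jvec e) ∘ fderiv ℝ W := by funext q; simp [QST]
/-- `gST` as a linear functional of `DW`. -/
theorem gST_eq_comp : gST W e = evalCoord ((0 : ℝ), e) ∘ fderiv ℝ W := by funext q; simp [gST]

variable {W e}

/-- Derivative of `q ↦ ⟪c, DW(q)[u]⟩`: `⟪c, D²W(q)[v][u]⟫`. -/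
theorem fderiv_inner_fderiv_apply {q : ℝ × E3} (hW : DifferentiableAt ℝ (fderiv ℝ W) q) (u v : ℝ × E3) (c : E3) :
    fderiv ℝ (fun q' => ⟪c, fderiv ℝ W q' u⟫_ℝ) q v = ⟪c, fderiv ℝ (fderiv ℝ W) q v u⟫_ℝ := by
  have hfun : (fun q' => ⟪c, fderiv ℝ W q' u⟫_ℝ) = evalInner u c ∘ fderiv ℝ W := by funext q'; simp
  rw [hfun, ((evalInner u c).hasFDerivAt.comp q hW.hasFDerivAt).fderiv]
  simp

/-- Derivative of `q ↦ (DW(q)[u])₂`: `(D²W(q)[v][u])₂`. -/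
theorem fderiv_coord_fderiv_apply {q : ℝ × E3} (hW : DifferentiableAt ℝ (fderiv ℝ W) q) (u v : ℝ × E3) :
    fderiv ℝ (fun q' => fderiv ℝ W q' u 2) q v = fderiv ℝ (fderiv ℝ W) q v u 2 := by
  have hfun : (fun q' => fderiv ℝ W q' u 2) = evalCoord u ∘ fderiv ℝ W := by funext q'; simp
  rw [hfun, ((evalCoord u).hasFDerivAt.comp q hW.hasFDerivAt).fderiv]
  simp

/-- Slice derivative = joint derivative in a spatial direction: `D(W(t,·))(x)[v] = DW(t,x)[(0,v)]`. -/
theorem fderiv_slice_eq {t : ℝ} {x : E3} (hW : DifferentiableAt ℝ W (t, x)) (v : E3) :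
    fderiv ℝ (fun y => W (t, y)) x v = fderiv ℝ W (t, x) ((0 : ℝ), v) := by
  have h := hW.hasFDerivAt.comp x (hasFDerivAt_prodMk_right t x)
  rw [show (W ∘ Prod.mk t) = fun y => W (t, y) from rfl] at h
  rw [h.fderiv]
  simp

variable {T : Set ℝ} {O : Set Y3} {D : Set (ℝ × ℝ)} {d : ℝ × ℝ → ℝ}

/-- Regularity facts at a point of `T × ℝ³` for `W ∈ C^∞(T × ℝ³)`. -/
theorem regular_at (hT : IsOpen T) (hW : ContDiffOn ℝ ∞ W (T ×ˢ (univ : Set E3))) {q : ℝ × E3} (hq : q.1 ∈ T) :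
    ContDiffAt ℝ ∞ W q ∧ DifferentiableAt ℝ W q ∧ DifferentiableAt ℝ (fderiv ℝ W) q ∧
      (∀ v w, fderiv ℝ (fderiv ℝ W) q v w = fderiv ℝ (fderiv ℝ W) q w v) := by
  have hWq : ContDiffAt ℝ ∞ W q := hW.contDiffAt ((hT.prod isOpen_univ).mem_nhds ⟨hq, mem_univ _⟩)
  refine ⟨hWq, hWq.differentiableAt (by simp), (hWq.fderiv_right (m := 1) (by norm_cast)).differentiableAt (by norm_num), fun v w => ?_⟩
  exact hWq.isSymmSndFDerivAt (by simp only [minSmoothness_of_isRCLikeNormedField]; norm_cast) v w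

/-- `gST, PST, QST` are smooth on `T × ℝ³`. -/
theorem contDiffOn_gST_PST_QST (hT : IsOpen T) (hW : ContDiffOn ℝ ∞ W (T ×ˢ (univ : Set E3))) :
    ContDiffOn ℝ ∞ (gST W e) (T ×ˢ (univ : Set E3)) ∧ ContDiffOn ℝ ∞ (PST W e) (T ×ˢ (univ : Set E3)) ∧
      ContDiffOn ℝ ∞ (QST W e) (T ×ˢ (univ : Set E3)) := by
  have hD : ContDiffOn ℝ ∞ (fderiv ℝ W) (T ×ˢ (univ : Set E3)) := hW.fderiv_of_isOpen (hT.prod isOpen_univ) (by simp)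
  refine ⟨?_, ?_, ?_⟩
  · rw [gST_eq_comp]; exact (evalCoord _).contDiff.comp_contDiffOn hD
  · rw [PST_eq_comp]; exact (evalInner _ _).contDiff.comp_contDiffOn hD
  · rw [QST_eq_comp]; exact (evalInner _ _).contDiff.comp_contDiffOn hD

/-- Analytic slices of `W` give analytic slices of `gST, PST, QST`. -/
theorem analyticOnNhd_slices (hT : IsOpen T) (hW : ContDiffOn ℝ ∞ W (T ×ˢ (univ : Set E3)))
    (hWan : ∀ t ∈ T, AnalyticOnNhd ℝ (fun x : E3 => W (t, x)) univ) {t : ℝ} (ht : t ∈ T) :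
    AnalyticOnNhd ℝ (fun x : E3 => gST W e (t, x)) univ ∧ AnalyticOnNhd ℝ (fun x : E3 => PST W e (t, x)) univ ∧
      AnalyticOnNhd ℝ (fun x : E3 => QST W e (t, x)) univ := by
  have hsl : AnalyticOnNhd ℝ (fderiv ℝ (fun x : E3 => W (t, x))) univ := (hWan t ht).fderiv
  have hev : AnalyticOnNhd ℝ (fun x : E3 => fderiv ℝ (fun y : E3 => W (t, y)) x e) univ := fun x _ =>
    (ContinuousLinearMap.apply ℝ E3 e).analyticAt _ |>.comp (hsl x (mem_univ _))
  have heq : ∀ x : E3, fderiv ℝ (fun y : E3 => W (t, y)) x e = fderiv ℝ W (t, x) ((0 : ℝ), e) := fun x =>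
    fderiv_slice_eq ((regular_at hT hW (q := (t, x)) ht).2.1) e
  refine ⟨fun x _ => ?_, fun x _ => ?_, fun x _ => ?_⟩
  · have h := ((EuclideanSpace.proj (𝕜 := ℝ) (2 : Fin 3)).analyticAt _).comp (hev x (mem_univ _))
    have hfun : (⇑(EuclideanSpace.proj (𝕜 := ℝ) (2 : Fin 3)) ∘ fun x : E3 => fderiv ℝ (fun y : E3 => W (t, y)) x e) = fun x => gST W e (t, x) := by
      funext x; simp [gST, heq x]
    rw [hfun] at h; exact h
  · have h := ((innerSL ℝ e).analyticAt _).comp (hev x (mem_univ _))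
    have hfun : (⇑(innerSL ℝ e) ∘ fun x : E3 => fderiv ℝ (fun y : E3 => W (t, y)) x e) = fun x => PST W e (t, x) := by
      funext x; simp [PST, heq x]
    rw [hfun] at h; exact h
  · have h := ((innerSL ℝ (Jvec e)).analyticAt _).comp (hev x (mem_univ _))
    have hfun : (⇑(innerSL ℝ (Jvec e)) ∘ fun x : E3 => fderiv ℝ (fun y : E3 => W (t, y)) x e) = fun x => QST W e (t, x) := by
      funext x; simp [QST, heq x]
    rw [hfun] at h; exact h

/-! ### The two kinematic rows of the mixed system on the tube -/

/-- ★ **`∂_m(P∘Φ) = ∂_s(Q∘Φ)`** on the tube, from POLOIDAL slices (`(curl W(t,·))₂ = 0` for `t ∈ T`), `e` horizontal. -/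
theorem pd_dN_PST_eq (hT : IsOpen T) (hW : ContDiffOn ℝ ∞ W (T ×ˢ (univ : Set E3)))
    (hcurl : ∀ t ∈ T, ∀ x : E3, FluidPDE.curl (fun y : E3 => W (t, y)) x 2 = 0) (he2 : e 2 = 0)
    (hOT : ∀ y ∈ O, y.1 ∈ T) (hD : IsOpen D) (hd : ContDiffOn ℝ ∞ d D) (hOD : ∀ y ∈ O, (y.1, y.2.2) ∈ D) {p : Y3 × ℝ} (hp : p ∈ tube O) :
    pd dN (PST W e ∘ shearMap e d) p = pd (tg eS) (QST W e ∘ shearMap e d) p := by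
  obtain ⟨hPs, hQs⟩ := (contDiffOn_gST_PST_QST (e := e) hT hW).2
  obtain ⟨hPd, -, hdp⟩ := differentiableAt_data (F := PST W e) hT hPs hOT hD hd hOD hp
  obtain ⟨hQd, -, -⟩ := differentiableAt_data (F := QST W e) hT hQs hOT hD hd hOD hp
  set q := shearMap e d p with hq_def
  have hq1 : q.1 ∈ T := (shearMap_mem (e := e) (d := d) hOT hp).1
  obtain ⟨hWq, hWd, hDWd, hsymm⟩ := regular_at hT hW hq1
  rw [pd_dN_comp_shearMap e d hPd hdp, pd_tgS_comp_shearMap e d hQd hdp]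
  -- `∂_m(P∘Φ) = ⟪e, D²W(q)[(0,Je)][(0,e)]⟫`, `∂_s(Q∘Φ) = ⟪Je, D²W(q)[(0,e)][(0,e)]⟫`
  rw [show PST W e = fun q' => ⟪e, fderiv ℝ W q' ((0 : ℝ), e)⟫_ℝ from rfl, show QST W e = fun q' => ⟪Jvec e, fderiv ℝ W q' ((0 : ℝ), e)⟫_ℝ from rfl,
    fderiv_inner_fderiv_apply hDWd, fderiv_inner_fderiv_apply hDWd]
  -- the symmetry `⟪e, DW(q')[(0,Je)]⟫ = ⟪Je, DW(q')[(0,e)]⟫` near `q` (poloidal slices), differentiated along `(0,e)`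
  have hJ2 : (Jvec e) 2 = 0 := by simp [Jvec]
  have hS : (fun q' : ℝ × E3 => ⟪e, fderiv ℝ W q' ((0 : ℝ), Jvec e)⟫_ℝ) =ᶠ[𝓝 q] fun q' => ⟪Jvec e, fderiv ℝ W q' ((0 : ℝ), e)⟫_ℝ := by
    filter_upwards [(hT.prod isOpen_univ).mem_nhds (show q ∈ T ×ˢ (univ : Set E3) from ⟨hq1, mem_univ _⟩)] with q' hq'
    have hWd' : DifferentiableAt ℝ W (q'.1, q'.2) := (regular_at hT hW (q := q') hq'.1).2.1
    have h := inner_fderiv_comm_of_curl_two_eq_zero (hcurl q'.1 hq'.1 q'.2) (k₁ := e) (k₂ := Jvec e) he2 hJ2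
    rw [fderiv_slice_eq hWd' (Jvec e), fderiv_slice_eq hWd' e] at h
    simpa only [Prod.mk.eta, real_inner_comm] using h
  have hD : fderiv ℝ (fun q' : ℝ × E3 => ⟪e, fderiv ℝ W q' ((0 : ℝ), Jvec e)⟫_ℝ) q ((0 : ℝ), e) =
      fderiv ℝ (fun q' : ℝ × E3 => ⟪Jvec e, fderiv ℝ W q' ((0 : ℝ), e)⟫_ℝ) q ((0 : ℝ), e) := by rw [hS.fderiv_eq]
  rw [fderiv_inner_fderiv_apply hDWd, fderiv_inner_fderiv_apply hDWd, hsymm] at hD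
  exact hD

/-- ★ **`∂_m(Q∘Φ) = −∂_s(P∘Φ) − (∂_z′ − d_z∂_m)(g∘Φ)`** on the tube, from DIVERGENCE-FREE slices, `e` a horizontal unit vector. -/
theorem pd_dN_QST_eq (hT : IsOpen T) (hW : ContDiffOn ℝ ∞ W (T ×ˢ (univ : Set E3)))
    (hdiv : ∀ t ∈ T, FluidPDE.VectorCalculus.IsDivFree (fun y : E3 => W (t, y))) (he2 : e 2 = 0) (hunit : e 0 ^ 2 + e 1 ^ 2 = 1)
    (hOT : ∀ y ∈ O, y.1 ∈ T) (hD : IsOpen D) (hd : ContDiffOn ℝ ∞ d D) (hOD : ∀ y ∈ O, (y.1, y.2.2) ∈ D) {p : Y3 × ℝ} (hp : p ∈ tube O) :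
    pd dN (QST W e ∘ shearMap e d) p =
      -pd (tg eS) (PST W e ∘ shearMap e d) p
        - (pd (tg eZ) (gST W e ∘ shearMap e d) p - fderiv ℝ d (p.1.1, p.1.2.2) ((0 : ℝ), (1 : ℝ)) * pd dN (gST W e ∘ shearMap e d) p) := by
  obtain ⟨hgs, hPs, hQs⟩ := contDiffOn_gST_PST_QST (e := e) hT hW
  obtain ⟨hPd, -, hdp⟩ := differentiableAt_data (F := PST W e) hT hPs hOT hD hd hOD hp
  obtain ⟨hQd, -, -⟩ := differentiableAt_data (F := QST W e) hT hQs hOT hD hd hOD hp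
  obtain ⟨hgd, -, -⟩ := differentiableAt_data (F := gST W e) hT hgs hOT hD hd hOD hp
  set q := shearMap e d p with hq_def
  have hq1 : q.1 ∈ T := (shearMap_mem (e := e) (d := d) hOT hp).1
  obtain ⟨hWq, hWd, hDWd, hsymm⟩ := regular_at hT hW hq1
  rw [pd_tgZ_sub_comp_shearMap e d hgd hdp, pd_dN_comp_shearMap e d hQd hdp, pd_tgS_comp_shearMap e d hPd hdp]
  rw [show PST W e = fun q' => ⟪e, fderiv ℝ W q' ((0 : ℝ), e)⟫_ℝ from rfl, show QST W e = fun q' => ⟪Jvec e, fderiv ℝ W q' ((0 : ℝ), e)⟫_ℝ from rfl,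
    show gST W e = fun q' => fderiv ℝ W q' ((0 : ℝ), e) 2 from rfl,
    fderiv_inner_fderiv_apply hDWd, fderiv_inner_fderiv_apply hDWd, fderiv_coord_fderiv_apply hDWd]
  -- the frame trace identity `⟪e, DW[(0,e)]⟫ + ⟪Je, DW[(0,Je)]⟫ + DW[(0,e₂)]₂ = 0` near `q` (divergence-free slices)
  have htr : (fun q' : ℝ × E3 => ⟪e, fderiv ℝ W q' ((0 : ℝ), e)⟫_ℝ + ⟪Jvec e, fderiv ℝ W q' ((0 : ℝ), Jvec e)⟫_ℝ + fderiv ℝ W q' ((0 : ℝ), e2) 2)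
      =ᶠ[𝓝 q] fun _ => (0 : ℝ) := by
    filter_upwards [(hT.prod isOpen_univ).mem_nhds (show q ∈ T ×ˢ (univ : Set E3) from ⟨hq1, mem_univ _⟩)] with q' hq'
    have hWd' : DifferentiableAt ℝ W (q'.1, q'.2) := (regular_at hT hW (q := q') hq'.1).2.1
    -- bilinear form `(a,b) ↦ ⟪b, DW(q')[(0,a)]⟫`
    set B : E3 →L[ℝ] E3 →L[ℝ] ℝ :=
      ((innerSL ℝ (E := E3)).flip).comp ((fderiv ℝ W q').comp (ContinuousLinearMap.inr ℝ ℝ E3)) with hB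
    have hBab : ∀ a b : E3, B a b = ⟪b, fderiv ℝ W q' ((0 : ℝ), a)⟫_ℝ := fun a b => by
      first
        | (simp only [hB, ContinuousLinearMap.coe_comp, Function.comp_apply, ContinuousLinearMap.flip_apply, ContinuousLinearMap.inr_apply]; done)
        | (simp only [hB, ContinuousLinearMap.coe_comp, Function.comp_apply, ContinuousLinearMap.flip_apply, ContinuousLinearMap.inr_apply]
           rfl)
    have hfr := bilin_frame_trace B he2 hunit
    rw [hBab, hBab, hBab, hBab] at hfr
    have hc : ∀ i : Fin 3, ⟪EuclideanSpace.single i (1 : ℝ), fderiv ℝ W q' ((0 : ℝ), EuclideanSpace.single i (1 : ℝ))⟫_ℝ =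
        fderiv ℝ (fun y : E3 => W (q'.1, y)) q'.2 (EuclideanSpace.single i (1 : ℝ)) i := fun i => by
      rw [EuclideanSpace.inner_single_left, fderiv_slice_eq hWd']; simp
    rw [hc 0, hc 1] at hfr
    have hdv := div_coord (hdiv q'.1 hq'.1) q'.2
    rw [fderiv_slice_eq hWd' (EuclideanSpace.single 2 (1 : ℝ))] at hdv
    rw [hfr, show e2 = EuclideanSpace.single 2 (1 : ℝ) from rfl]
    linarith
  -- differentiate the (locally vanishing) sum at `q` along `(0,e)`
  have hA : HasFDerivAt (fun q' : ℝ × E3 => ⟪e, fderiv ℝ W q' ((0 : ℝ), e)⟫_ℝ)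
      ((evalInner ((0 : ℝ), e) e).comp (fderiv ℝ (fderiv ℝ W) q)) q :=
    ((evalInner ((0 : ℝ), e) e).hasFDerivAt.comp q hDWd.hasFDerivAt).congr_of_eventuallyEq (Eventually.of_forall fun q' => by simp)
  have hB : HasFDerivAt (fun q' : ℝ × E3 => ⟪Jvec e, fderiv ℝ W q' ((0 : ℝ), Jvec e)⟫_ℝ)
      ((evalInner ((0 : ℝ), Jvec e) (Jvec e)).comp (fderiv ℝ (fderiv ℝ W) q)) q :=
    ((evalInner ((0 : ℝ), Jvec e) (Jvec e)).hasFDerivAt.comp q hDWd.hasFDerivAt).congr_of_eventuallyEq (Eventually.of_forall fun q' => by simp)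
  have hC : HasFDerivAt (fun q' : ℝ × E3 => fderiv ℝ W q' ((0 : ℝ), e2) 2)
      ((evalCoord ((0 : ℝ), e2)).comp (fderiv ℝ (fderiv ℝ W) q)) q :=
    ((evalCoord ((0 : ℝ), e2)).hasFDerivAt.comp q hDWd.hasFDerivAt).congr_of_eventuallyEq (Eventually.of_forall fun q' => by simp)
  have hsum := (hA.fun_add hB).fun_add hC
  have hzero : HasFDerivAt (fun q' : ℝ × E3 => ⟪e, fderiv ℝ W q' ((0 : ℝ), e)⟫_ℝ + ⟪Jvec e, fderiv ℝ W q' ((0 : ℝ), Jvec e)⟫_ℝ +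
      fderiv ℝ W q' ((0 : ℝ), e2) 2) (0 : ℝ × E3 →L[ℝ] ℝ) q :=
    (hasFDerivAt_const (0 : ℝ) q).congr_of_eventuallyEq htr
  have hD := congrArg (fun L : ℝ × E3 →L[ℝ] ℝ => L ((0 : ℝ), e)) (hsum.unique hzero)
  simp only [add_apply, ContinuousLinearMap.coe_comp, Function.comp_apply, evalInner_apply, evalCoord_apply] at hD
  -- `D²W[(0,e)][(0,Je)] = D²W[(0,Je)][(0,e)]`, `D²W[(0,e)][(0,e₂)] = D²W[(0,e₂)][(0,e)]`
  rw [hsymm ((0 : ℝ), e) ((0 : ℝ), Jvec e), hsymm ((0 : ℝ), e) ((0 : ℝ), e2)] at hD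
  have h0 : ((0 : ℝ × E3 →L[ℝ] ℝ) : ℝ × E3 → ℝ) ((0 : ℝ), e) = 0 := rfl
  rw [h0] at hD
  linarith

end Summit.NavierStokesRegularity.NavierStokesRegularity.Theorems.PoloidalWindowDoorLrcModEntireShearedKinematics
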